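import Summits.ResolutionOfSingularities.ResolutionOfSingularities.Theorems.EquisingularLiftEquisingularLiftNatClusterStepDefs
import HarnessLib

/-!
# Route `EquisingularLift`, crux EL♮ (stmt-ResolutionOfSingularities-20038) / EL♮(3) (stmt-…-20148) — named DOWNSTAIRS predicates
# of the lead's skeleton, rung v7′ (TC⁺⁺) — CLUSTERSTEP v3: the TANGENT-WITNESS clause (Defs v2, append-only over …NatClusterStepDefs p531557)

res-L1-w45b-lead-2 g2 (lead) with res-L1-w45b-stub-3 (fragment `L/res-L1-w45b-stub-3/CLUSTERSTEP-DELTA.lean` 09ab8846f4e69326, VERBATIM: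
`ClusterTangentWitness`, `CarrierCluster₂`) after res-L1-w45b-stub-4's DESIGN NOTE 2026-08-27T13:00:53Z and the lead ruling 13:05:02Z
(child skeleton v9 = TC⁺⁺ cut over the v1 clause WITHDRAWN; re-cut over `CarrierCluster₂`). OURS; planning vocabulary of the crux chain,
not a statement of any manuscript; AI-written, weaker than expert review. Every predicate is DOWNSTAIRS-ONLY.

WHY (stub-4): `ClusterNonSuperabundant` (jets of order `< m_t` independent) does not control the order-`m_t` INITIAL FORM of a member of
the cluster system at a sectioned point; for HEAVY clusters (`Σ_t C(m_t+1,2) = C(dg+2,2) − 1`) the system is `span{g}` and NO member is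
Δ-regular over an infinitely-near non-regular point of `St(Z)` on the exceptional line, although every v1 clause holds — the upstairs
supplier (T-CLUSTER-LIFT part 9 `…_stCharts`, slot `hMstavoid`; part 11 …NatClusterLiftTangentWitness p535261) cannot deliver. FIX (stub-4's
uniform sufficient spelling): for every single point `t`, the cluster FATTENED BY ONE AT `t` is still non-superabundant.

* `ClusterTangentWitness dg s i a m := ∀ t, ClusterNonSuperabundant dg s i a (Function.update m t (m t + 1))` (stub-3, verbatim);
* `CarrierCluster₂ F₁ F₂ υ x W` := `CarrierCluster`'s body ∧ `ClusterTangentWitness` (stub-3, verbatim);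
* `ReachTCPlusPlus₂ F₁ F₂ υ x T₂ F' β T'` := `ReachTCPlusPlus` (p531557) with `CarrierCluster₂` in place of `CarrierCluster` (the lead's one
  token). The registered v7′ (v2) stub = K5′'s downstairs hypothesis (res-D-pv-029 `target_elnat_of_subchainResolution'`, p523491) at
  `Reach := ReachTCPlusPlus₂`; conditional instance = one application of K5′ (…NatTcPlusPlusTangentPointResolutionOfSubchainLift);
  upstairs debt HSUB′(ReachTCPlusPlus₂) = CHAIN v7.15 K8 brick board.
AUTOMATIC RANGE: `Σ_t m t + 1 ≤ dg + 1` gives `ClusterNonSuperabundant` and `ClusterTangentWitness` at once (`clusterNonSuperabundant_of_sum_le`,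
…NatClusterStepDischarge p532712).
-/

set_option linter.dupNamespace false

noncomputable section

open CategoryTheory AlgebraicGeometry TopologicalSpace IsLocalRing MvPolynomial
open Literature.AlgebraicGeometry.Resolution (IsBlowup dehomogenize stalkIdeal)

namespace Summit.ResolutionOfSingularities.ResolutionOfSingularities.Cruxes.EquisingularLiftNat.Sections

/-- **CLUSTERSTEP v3 / (b′) `ClusterTangentWitness`** — the TANGENT WITNESS (res-L1-w45b-stub-4 DESIGN NOTE 2026-08-27T13:00:53Z, accepted
by res-L1-w45b-lead-2 13:05:02Z): for EVERY single point `t` of the cluster, the cluster FATTENED BY ONE AT `t` ONLY (order `m t + 1` at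
`a t`, `m t'` elsewhere) is still non-superabundant. Then the jets of order `≤ m t` at `a t` — in particular every order-`m t` INITIAL FORM —
are realised inside the degree-`dg` cluster system, so the upstairs supplier can choose a member whose initial form at `a t` misses the
finitely many non-regular points of the strict transform on the exceptional line over `q_t` (Δ-genericity at INFINITELY-NEAR bad points,
which `ClusterNonSuperabundant` alone cannot supply: heavy clusters with `Σ_t C(m t + 1, 2) = C(dg + 2, 2) − 1` have `V_K = span{g}`).
AUTOMATIC when `Σ_t m t + 1 ≤ dg + 1`. Pure algebra; downstairs only. -/
def ClusterTangentWitness {k' : Type} [Field k'] (dg : ℕ) (s : ℕ) (i : Fin s → Fin 3)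
    (a : (t : Fin s) → {j : Fin 3 // j ≠ i t} → k') (m : Fin s → ℕ) : Prop :=
  ∀ t : Fin s, ClusterNonSuperabundant dg s i a (Function.update m t (m t + 1))

/-- **CLUSTERSTEP v3 / `CarrierCluster₂`** — `CarrierCluster` (p531557) WITH the tangent witness: ∃ carrier frame with initial form, ∃ residue
model `πk : 𝒪_{F₁,x} ↠ k'` (`ker = (c)`), ∃ reduced tangent form `g`, ∃ fat cluster (exact orders, distinct, covering every singular point) which is
non-superabundant AND has the tangent witness. (New name — append-only over v1.) Downstairs only. -/
def CarrierCluster₂ (F₁ F₂ : Scheme.{0}) (_υ : F₂ ⟶ F₁) (x : F₁) (W : Set F₁) : Prop :=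
  ∃ (c : Fin 3 → F₁.presheaf.stalk x) (d : ℕ) (Φ : MvPolynomial (Fin 3) (F₁.presheaf.stalk x)),
    CarrierFrame F₁ x W c d Φ ∧
    ∃ (k' : Type) (_ : Field k') (πk : F₁.presheaf.stalk x →+* k'),
      Function.Surjective πk ∧ RingHom.ker πk = Ideal.span (Set.range c) ∧
      ∃ (dg : ℕ) (g : MvPolynomial (Fin 3) k'), ReducedConeForm πk Φ dg g ∧
        ∃ (s : ℕ) (i : Fin s → Fin 3) (a : (t : Fin s) → {j : Fin 3 // j ≠ i t} → k') (m : Fin s → ℕ),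
          FatCluster g s i a m ∧ ClusterNonSuperabundant dg s i a m ∧ ClusterTangentWitness dg s i a m

/-- **ReachTCPlusPlus₂** — CLUSTERSTEP v3: the admissible downstairs sub-chain predicate of rung v7′ (TC⁺⁺) for K5′'s slot `Reach`, = `ReachTCPlusPlus`
(p531557) with `CarrierCluster` replaced by `CarrierCluster₂` (the ONE token change of res-L1-w45b-lead-2's ruling 2026-08-27T13:05:02Z):
rung v7's `W`-clauses, `CarrierCluster₂` (non-superabundant fat cluster of the singular points of the carrier curve `Z₂ = υ⁻¹{x} ∩ St W`
WITH the tangent witness), the tracker closure `ClusterReach`, then the blow-up of the carrier curve; ending at `(F', β = υ' ≫ β₉, T' = closure υ'⁻¹(T₉ ∖ Z₉))`. -/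
def ReachTCPlusPlus₂ (F₁ F₂ : AlgebraicGeometry.Scheme.{0}) (υ : F₂ ⟶ F₁) (x : F₁) (T₂ : Set F₂)
    (F' : AlgebraicGeometry.Scheme.{0}) (β : F' ⟶ F₂) (T' : Set F') : Prop :=
  ∃ (W : Set F₁) (F₉ : AlgebraicGeometry.Scheme.{0}) (β₉ : F₉ ⟶ F₂) (T₉ Z₉ : Set F₉) (hZ₉ : IsClosed Z₉) (υ' : F' ⟶ F₉),
    (x ∈ W) ∧ (¬ (υ ⁻¹' {x} ⊆ closure (υ ⁻¹' (W \ {x})))) ∧ ((∃ U : F₁.affineOpens, x ∈ (U : F₁.Opens) ∧ ((AlgebraicGeometry.Scheme.IdealSheafData.vanishingIdeal (⟨closure W, isClosed_closure⟩ : TopologicalSpace.Closeds F₁)).ideal U).IsPrincipal)) ∧ ((υ ⁻¹' {x} ∩ closure (υ ⁻¹' (W \ {x}))) ⊆ T₂) ∧ CarrierCluster₂ F₁ F₂ υ x W ∧ ClusterReach F₂ T₂ (υ ⁻¹' {x} ∩ closure (υ ⁻¹' (W \ {x}))) F₉ β₉ T₉ Z₉ ∧ (Z₉ ⊆ T₉)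 ∧ (¬ (T₉ ⊆ Z₉)) ∧ (Set.Finite {z : ↥((AlgebraicGeometry.Scheme.IdealSheafData.vanishingIdeal (⟨Z₉, hZ₉⟩ : TopologicalSpace.Closeds F₉))).subscheme | ¬ IsRegularLocalRing (((AlgebraicGeometry.Scheme.IdealSheafData.vanishingIdeal (⟨Z₉, hZ₉⟩ : TopologicalSpace.Closeds F₉))).subscheme.presheaf.stalk z)}) ∧ (Literature.AlgebraicGeometry.Resolution.IsBlowup υ' (AlgebraicGeometry.Scheme.IdealSheafData.vanishingIdeal (⟨Z₉, hZ₉⟩ : TopologicalSpace.Closeds F₉))) ∧ β = CategoryTheory.CategoryStruct.comp υ' β₉ ∧ T' = closure (υ' ⁻¹' (T₉ \ Z₉))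

end Summit.ResolutionOfSingularities.ResolutionOfSingularities.Cruxes.EquisingularLiftNat.Sections

end
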